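import Summits.QuantumFields.BalabanUV.Beta.EriceRemainderEnclosureHistoryUniqueness
import Summits.QuantumFields.BalabanUV.Beta.EriceRemainderEnclosureHistoryRenewal
import Summits.QuantumFields.BalabanUV.Beta.EriceRemainderEnclosureHistoryRenewalBlocks

/-!
# EriceRemainderEnclosureHistoryRenewalRate — (E33c) NODE U2'S COUPLING MATCHING WITHOUT `FadingMemory`: under NE4 as typed
# (`ScaleShiftRate`), a history modulus with ONLY a k-uniform ROW TOTAL WEIGHT, near-monotone asymptotically free runs and the
# smallness `q = A³·M·U < 1`, two infrared-pinned runs of (0.20) of `K` and `K + 1` steps match at the STRETCHED-EXPONENTIAL rate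
# `|1∕(g^A_j)² − 1∕(g^B_{j+1})²| ≤ c∕((1−θ)(1−q))·(2K+2)·max(θ,q)^⌊√j⌋`

Cell `pub-balaban`, β-function sub-cell, BINDER row D4 «RemainderConst leaves for Bałaban's split» (`HOME/BINDER-OWNERS.md`; owner
lineage `b2b-balaban-beta-an4`; this file by co-owner #2 lineage `b2b-balaban-beta-d4-p2`, generation 35), β-FLOW TEAM duty (1),
FREEZE (0) honoured (def-free; no new leaf, no new hypothesis shape).  The run-level END of station (E33): composition BY NAME of (E33a)
`EriceRemainderEnclosureHistoryRenewal.disc_row_split` ∕ `disc_row_full` (the row split from `ScaleShiftRate` + rows), (E33b)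
`EriceRemainderEnclosureHistoryRenewalBlocks.stretched_of_split` ∕ `stretched_sqrt_of_split` (the block renewal), (E32)
`EriceRemainderEnclosureHistoryUniqueness.nearMono_of_sign` ∕ `nearMono_of_eventualLower` (asymptotic freedom orders the history) and
node U2's `T4CouplingMatching.sum_weights_le_of_eventualLower` (the K-uniform AF weight sum `U = (k₀+1)γ³ + 2γ∕b`).  Companion (E33d)
`EriceRemainderEnclosureHistoryRenewalContinuum` draws the consequences at a fixed infrared distance.

HONEST FRAMING (page 1, verbatim and binding).  *"Discharging BetaPertH makes Bałaban's UV stability UNCONDITIONAL — a real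
constructive-QFT result; it is NOT the continuum limit and NOT the Clay problem."*  THIS FILE DISCHARGES NOTHING OF THE KIND.  Every
β-side input is a NAMED BINDER on an ABSTRACT family `β : FlowStep.HBeta`, NOT PRINTED and NOT asserted for [I] (1.22): node U2's
`ScaleShiftRate c θ γ β` (GAPS G-t4-U2-1), `HistLipschitz Λ γ β` with a k-uniform row total weight (GAPS G-t4-U2-2),
`EventualLowerH b γ k₀ β` (shape of (0.31)'s lower half), the sign `FlowStep.BetaLowerH 0` or the lower half `β ≥ −β′` of the
PRINTED-type two-sided bound (p. 264 «uniformly bounded», constant unprinted).  Nothing of Bałaban's is quoted newly (loci verbatim in the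
headers of `FlowStep` ∕ `T4CouplingMatching`).  Row D4 class UNCHANGED (critical-path width 0; instance 0∕1; D4 DISCHARGE NO DATE).
HONEST DEPENDENCY: continuum YM on T⁴ ⇐ BetaPertH ∧ nine spine estimates (0/9 proved); BetaPertH ⇐ (D1) ∧ (D4) ∧ CAP+tail; G-an2-4 gates
asym, D1 and NE2/3/4.

THE POINT (census sense (α)).  Node U2's `disc_le_of_fadingMemory` — binders: two pinned runs in the box, `ScaleShiftRate c θ γ β`,
`HistLipschitz Λ γ β`, `FadingMemory C θ Λ`, `Σ u ≤ U`, `C·U ≤ (1−θ)∕2` — concludes the GEOMETRIC rate `(2c∕(1−θ))·θ^j`.  Here the SAME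
list with `FadingMemory C θ Λ` REPLACED by «`Λ ≥ 0`, rows `Σ_{i≤k} Λ k i ≤ M`» + near-monotone runs (from the sign: `A = 1`; or from
the eventual floor + two-sided bound + `k₀β′γ² ≤ 1∕2`: `A = √2`) and the smallness `q = A³·M·U < 1` (node U2's `C·U < 1 − θ` in row-sum
currency, as in (E32)) concludes the STRETCHED-EXPONENTIAL rate `c∕((1−θ)(1−q))·(2K+2)·max(θ,q)^⌊√j⌋` — decaying in the ultraviolet
index `j`, hence (companion (E33d)) summable over the cutoff at every fixed infrared distance: the continuum recursion variable
exists WITHOUT any decay of the memory in the age.  What `FadingMemory` buys in node U2 is the geometric SHAPE, i.e. the typed source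
`T4CauchySum.InjectedRate C 0 θ` as STATED — not the existence leg.  (The factor `2K+2` here comes from the FIXED window: the
window-independent deletion term is summed over `≤ K` rows; the companions (E33f) `EriceRemainderEnclosureHistoryRenewalUniform`
(dyadic windows) and (E33g) `EriceRemainderEnclosureHistoryRenewalStretched` (windows `⌊√l⌋`: `L·ρ^⌊√j⌋`, K-uniform) remove it.)
Whether the stretched shape is sharp for adversarial admissible families is NOT decided here.

WHAT IS PROVED ([folklore] real analysis + by-name composition; 0 `def`, 0 sorry; nothing of [I] asserted).
 `disc_le_renewal` (free window `s ≥ 1` and depth `t`, `t·s ≤ j`: `disc_j ≤ c∕((1−θ)(1−q))·((2K+1)θ^s + q^t)`), **`disc_le_stretched`**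
 (near-monotone runs, constant `A`), **`disc_le_stretched_sign`** (`A = 1`: sign + eventual floor, smallness `M·U < 1`),
 **`disc_le_stretched_eventual`** (`A = √2`: eventual floor + `β ≥ −β′` + `k₀β′γ² ≤ 1∕2`, smallness `2√2·M·U < 1`), `U = (k₀+1)γ³ + 2γ∕b`.
-/

noncomputable section
open Finset

namespace Summit.QuantumFields.BalabanUV.Beta.EriceRemainderEnclosureHistoryRenewalRate

open Literature.MathematicalPhysics.QuantumFieldTheory.Balaban1983to89
open Literature.MathematicalPhysics.QuantumFieldTheory.Balaban1983to89.FlowStep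
open Literature.MathematicalPhysics.QuantumFieldTheory.Balaban1983to89.T4CouplingMatching
open Summit.QuantumFields.BalabanUV.Beta.EriceRemainderEnclosureHistoryUniqueness
  (nearMono_of_sign sign_along_of_betaLowerH nearMono_of_eventualLower)
open Summit.QuantumFields.BalabanUV.Beta.EriceRemainderEnclosureHistoryRenewal (disc_row_split disc_row_full)
open Summit.QuantumFields.BalabanUV.Beta.EriceRemainderEnclosureHistoryRenewalBlocks (stretched_of_split stretched_sqrt_of_split)

/-! ## Run level: node U2's binder list with `FadingMemory` replaced by «rows ≤ M» + near-monotonicity -/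

/-- **TWO RUNS, FREE WINDOW AND DEPTH.**  Two runs of (0.20) with the SAME history family `β` — A: `K` steps, B: `K + 1` steps — all
couplings in ]0,γ], pinned `g^A_K = g^B_{K+1}`; NE4 as `ScaleShiftRate c θ γ β` (`c ≥ 0`, `0 ≤ θ < 1`); history moduli
`HistLipschitz Λ γ β`, `Λ ≥ 0`, with ONLY the k-uniform ROW total weight `Σ_{i≤k} Λ k i ≤ M`; near-monotone runs (`g^X_i ≤ A·g^X_j`,
`i ≤ j`); the AF weight bound `Σ_{i≤K} (g^A_i)²g^B_{i+1} ≤ U`; SMALLNESS `q = A³·M·U < 1`.  THEN for every scale `j ≤ K`, window `s ≥ 1`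
and depth `t` with `t·s ≤ j`: `disc gA gB j ≤ c∕((1−θ)(1−q))·((2K+1)θ^s + q^t)`.  NO `FadingMemory`.  Every hypothesis on `β` is an
UNPRINTED input (GAPS G-t4-U2-1∕-2); the theorem is bookkeeping ((E33a) §2 + (E33b) §3). [cite: Balaban1987RG1, (0.20) p.256 and §5 p.298] -/
theorem disc_le_renewal {β : HBeta} {γ c θ M A U : ℝ} {Λ : ℕ → ℕ → ℝ} {K : ℕ} {gA gB : ℕ → ℝ}
    (hc : 0 ≤ c) (hθ0 : 0 ≤ θ) (hθ1 : θ < 1)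
    (hA : RGEqH K β gA) (hB : RGEqH (K + 1) β gB)
    (hAbox : ∀ i, i ≤ K → 0 < gA i ∧ gA i ≤ γ) (hBbox : ∀ i, i ≤ K + 1 → 0 < gB i ∧ gB i ≤ γ)
    (hpin : gA K = gB (K + 1))
    (hS : ScaleShiftRate c θ γ β) (hL : HistLipschitz Λ γ β) (hΛ : ∀ k i, i ≤ k → 0 ≤ Λ k i) (hM : 0 ≤ M)
    (hrow : ∀ k, ∑ i ∈ range (k + 1), Λ k i ≤ M) (hA0 : 0 ≤ A)
    (hmA : ∀ i j, i ≤ j → j ≤ K → gA i ≤ A * gA j) (hmB : ∀ i j, i ≤ j → j ≤ K + 1 → gB i ≤ A * gB j)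
    (hU : ∑ i ∈ range (K + 1), (gA i) ^ 2 * gB (i + 1) ≤ U) (hsmall : A ^ 3 * M * U < 1)
    {j s t : ℕ} (hj : j ≤ K) (hs : 1 ≤ s) (hts : t * s ≤ j) :
    disc gA gB j ≤ c / ((1 - θ) * (1 - A ^ 3 * M * U)) * ((2 * K + 1) * θ ^ s + (A ^ 3 * M * U) ^ t) := by
  have hw : ∀ i, i ≤ K → 0 ≤ (gA i) ^ 2 * gB (i + 1) := fun i hi => mul_nonneg (sq_nonneg _) (hBbox (i + 1) (by omega)).1.le
  have hU0 : 0 ≤ U := (sum_nonneg fun i hi => hw i (Nat.lt_succ_iff.mp (mem_range.mp hi))).trans hU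
  have hm : 0 ≤ A ^ 3 * M := mul_nonneg (pow_nonneg hA0 3) hM
  have e3 : A ^ 3 * M * U = (A ^ 3 * M) * U := by ring
  rw [e3] at hsmall ⊢
  exact stretched_of_split (δ := disc gA gB) (w := fun i => (gA i) ^ 2 * gB (i + 1)) hθ0 hθ1 hc hw hm hU hU0 hsmall
    (disc_pin hpin) (disc_nonneg gA gB)
    (fun j hj B' hB' => disc_row_full hA hB hAbox hBbox hS hL hΛ hrow hA0 hmA hmB hj hB')
    (fun j hj B' hB' => disc_row_split hc hθ0 hθ1 hA hB hAbox hBbox hS hL hΛ hrow hA0 hmA hmB hj hB') hj hs hts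

/-- **NODE U2 WITHOUT FADING MEMORY — THE STRETCHED-EXPONENTIAL MATCHING RATE.**  Under the binder list of `disc_le_renewal` (node U2's
`disc_le_of_fadingMemory` list with `FadingMemory C θ Λ` REPLACED by the k-uniform ROW total weight `M` of the modulus + near-monotone
runs, smallness `q = A³·M·U < 1`): for EVERY `j ≤ K`,
`|1∕(g^A_j)² − 1∕(g^B_{j+1})²| ≤ c∕((1−θ)(1−q)) · (2K+2) · max(θ, q)^(Nat.sqrt j)` — stretched-exponential in the ultraviolet index `j`.
The decay of the memory in the age is NOT used; what it buys in node U2 is the geometric SHAPE `(2c∕(1−θ))·θ^j` (and the K-uniform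
constant), not the decay of the discrepancy. [cite: Balaban1987RG1, (0.20) p.256 and §5 p.298] -/
theorem disc_le_stretched {β : HBeta} {γ c θ M A U : ℝ} {Λ : ℕ → ℕ → ℝ} {K : ℕ} {gA gB : ℕ → ℝ}
    (hc : 0 ≤ c) (hθ0 : 0 ≤ θ) (hθ1 : θ < 1)
    (hA : RGEqH K β gA) (hB : RGEqH (K + 1) β gB)
    (hAbox : ∀ i, i ≤ K → 0 < gA i ∧ gA i ≤ γ) (hBbox : ∀ i, i ≤ K + 1 → 0 < gB i ∧ gB i ≤ γ)
    (hpin : gA K = gB (K + 1))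
    (hS : ScaleShiftRate c θ γ β) (hL : HistLipschitz Λ γ β) (hΛ : ∀ k i, i ≤ k → 0 ≤ Λ k i) (hM : 0 ≤ M)
    (hrow : ∀ k, ∑ i ∈ range (k + 1), Λ k i ≤ M) (hA0 : 0 ≤ A)
    (hmA : ∀ i j, i ≤ j → j ≤ K → gA i ≤ A * gA j) (hmB : ∀ i j, i ≤ j → j ≤ K + 1 → gB i ≤ A * gB j)
    (hU : ∑ i ∈ range (K + 1), (gA i) ^ 2 * gB (i + 1) ≤ U) (hsmall : A ^ 3 * M * U < 1) :
    ∀ j, j ≤ K → disc gA gB j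
      ≤ c / ((1 - θ) * (1 - A ^ 3 * M * U)) * (2 * K + 2) * (max θ (A ^ 3 * M * U)) ^ Nat.sqrt j := by
  intro j hj
  have hw : ∀ i, i ≤ K → 0 ≤ (gA i) ^ 2 * gB (i + 1) := fun i hi => mul_nonneg (sq_nonneg _) (hBbox (i + 1) (by omega)).1.le
  have hU0 : 0 ≤ U := (sum_nonneg fun i hi => hw i (Nat.lt_succ_iff.mp (mem_range.mp hi))).trans hU
  have hm : 0 ≤ A ^ 3 * M := mul_nonneg (pow_nonneg hA0 3) hM
  have e3 : A ^ 3 * M * U = (A ^ 3 * M) * U := by ring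
  rw [e3] at hsmall ⊢
  exact stretched_sqrt_of_split (δ := disc gA gB) (w := fun i => (gA i) ^ 2 * gB (i + 1)) hθ0 hθ1 hc hw hm hU hU0 hsmall
    (disc_pin hpin) (disc_nonneg gA gB)
    (fun j hj B' hB' => disc_row_full hA hB hAbox hBbox hS hL hΛ hrow hA0 hmA hmB hj hB')
    (fun j hj B' hB' => disc_row_split hc hθ0 hθ1 hA hB hAbox hBbox hS hL hΛ hrow hA0 hmA hmB hj hB') hj

/-- **END, SIGN FORM** (`A = 1`): two pinned runs as above under `ScaleShiftRate c θ γ β`, `HistLipschitz Λ γ β` with rows `≤ M`, the SIGN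
`BetaLowerH 0 γ β` (the runs increase towards the infrared pin: (E30) `run_mono` ∕ (E32) `nearMono_of_sign` BY NAME) and the eventual
floor `EventualLowerH b γ k₀ β`, `b > 0` (node U2's K-uniform weight sum `U = (k₀+1)γ³ + 2γ∕b`, `sum_weights_le_of_eventualLower` BY NAME);
SMALLNESS `M·U < 1` — node U2's `C·U ≤ (1−θ)∕2` in row-sum currency, NO `FadingMemory`.  THEN for every `j ≤ K`:
`disc gA gB j ≤ c∕((1−θ)(1−MU))·(2K+2)·max(θ, MU)^(Nat.sqrt j)`. [cite: Balaban1987RG1, (0.20) p.256 and (0.31) p.259] -/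
theorem disc_le_stretched_sign {β : HBeta} {γ b c θ M : ℝ} {k₀ : ℕ} {Λ : ℕ → ℕ → ℝ} {K : ℕ} {gA gB : ℕ → ℝ}
    (hγ : 0 < γ) (hb : 0 < b) (hc : 0 ≤ c) (hθ0 : 0 ≤ θ) (hθ1 : θ < 1)
    (hA : RGEqH K β gA) (hB : RGEqH (K + 1) β gB)
    (hAbox : ∀ i, i ≤ K → 0 < gA i ∧ gA i ≤ γ) (hBbox : ∀ i, i ≤ K + 1 → 0 < gB i ∧ gB i ≤ γ)
    (hpin : gA K = gB (K + 1))
    (hS : ScaleShiftRate c θ γ β) (hL : HistLipschitz Λ γ β) (hΛ : ∀ k i, i ≤ k → 0 ≤ Λ k i) (hM : 0 ≤ M)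
    (hrow : ∀ k, ∑ i ∈ range (k + 1), Λ k i ≤ M)
    (hsign : BetaLowerH 0 γ β) (hlo : EventualLowerH b γ k₀ β)
    (hsmall : M * (((k₀ : ℝ) + 1) * γ ^ 3 + 2 * γ / b) < 1) :
    ∀ j, j ≤ K → disc gA gB j
      ≤ c / ((1 - θ) * (1 - M * (((k₀ : ℝ) + 1) * γ ^ 3 + 2 * γ / b))) * (2 * K + 2)
        * (max θ (M * (((k₀ : ℝ) + 1) * γ ^ 3 + 2 * γ / b))) ^ Nat.sqrt j := by
  have hU := sum_weights_le_of_eventualLower hγ hb hA hB hAbox hBbox hlo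
  have hmA := nearMono_of_sign hA (fun k hk => (hAbox k hk).1) (sign_along_of_betaLowerH hsign hAbox)
  have hmB := nearMono_of_sign hB (fun k hk => (hBbox k hk).1) (sign_along_of_betaLowerH hsign hBbox)
  have h := disc_le_stretched hc hθ0 hθ1 hA hB hAbox hBbox hpin hS hL hΛ hM hrow zero_le_one hmA hmB hU
    (by simpa using hsmall)
  simpa using h

/-- **END, EVENTUAL FORM** (`A = √2`, no sign): two pinned runs as above under `ScaleShiftRate c θ γ β`, `HistLipschitz Λ γ β` with rows
`≤ M`, the eventual floor `EventualLowerH b γ k₀ β` (`b > 0`), the lower half `β ≥ −β′` of the PRINTED-type two-sided bound (p. 264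
«uniformly bounded», constant unprinted) and `k₀·β′·γ² ≤ 1∕2` ((E32) `nearMono_of_eventualLower` BY NAME: `g_i ≤ √2·g_j`); SMALLNESS
`2√2·M·U < 1`, `U = (k₀+1)γ³ + 2γ∕b`.  THEN for every `j ≤ K`:
`disc gA gB j ≤ c∕((1−θ)(1−2√2·MU))·(2K+2)·max(θ, 2√2·MU)^(Nat.sqrt j)`.  NO `FadingMemory`.
[cite: Balaban1987RG1, (0.20) p.256 and §1 p.264] -/
theorem disc_le_stretched_eventual {β : HBeta} {γ b β' c θ M : ℝ} {k₀ : ℕ} {Λ : ℕ → ℕ → ℝ} {K : ℕ} {gA gB : ℕ → ℝ}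
    (hγ : 0 < γ) (hb : 0 < b) (hc : 0 ≤ c) (hθ0 : 0 ≤ θ) (hθ1 : θ < 1)
    (hA : RGEqH K β gA) (hB : RGEqH (K + 1) β gB)
    (hAbox : ∀ i, i ≤ K → 0 < gA i ∧ gA i ≤ γ) (hBbox : ∀ i, i ≤ K + 1 → 0 < gB i ∧ gB i ≤ γ)
    (hpin : gA K = gB (K + 1))
    (hS : ScaleShiftRate c θ γ β) (hL : HistLipschitz Λ γ β) (hΛ : ∀ k i, i ≤ k → 0 ≤ Λ k i) (hM : 0 ≤ M)
    (hrow : ∀ k, ∑ i ∈ range (k + 1), Λ k i ≤ M)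
    (hlo : EventualLowerH b γ k₀ β) (hβ' : 0 ≤ β') (hlow : ∀ k v, v ∈ Box γ k → -β' ≤ β k v)
    (hk₀ : (k₀ : ℝ) * β' * γ ^ 2 ≤ 1 / 2)
    (hsmall : 2 * Real.sqrt 2 * M * (((k₀ : ℝ) + 1) * γ ^ 3 + 2 * γ / b) < 1) :
    ∀ j, j ≤ K → disc gA gB j
      ≤ c / ((1 - θ) * (1 - 2 * Real.sqrt 2 * M * (((k₀ : ℝ) + 1) * γ ^ 3 + 2 * γ / b))) * (2 * K + 2)
        * (max θ (2 * Real.sqrt 2 * M * (((k₀ : ℝ) + 1) * γ ^ 3 + 2 * γ / b))) ^ Nat.sqrt j := by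
  have hU := sum_weights_le_of_eventualLower hγ hb hA hB hAbox hBbox hlo
  have hmA := nearMono_of_eventualLower hA hAbox hb.le hlo hβ' hlow hk₀
  have hmB := nearMono_of_eventualLower hB hBbox hb.le hlo hβ' hlow hk₀
  have hs3 : Real.sqrt 2 ^ 3 = 2 * Real.sqrt 2 := by
    rw [pow_succ, Real.sq_sqrt (by norm_num : (0 : ℝ) ≤ 2)]
  have h := disc_le_stretched hc hθ0 hθ1 hA hB hAbox hBbox hpin hS hL hΛ hM hrow (Real.sqrt_nonneg 2) hmA hmB hU
    (by rw [hs3]; exact hsmall)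
  rw [hs3] at h
  exact h

end Summit.QuantumFields.BalabanUV.Beta.EriceRemainderEnclosureHistoryRenewalRate

end
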